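import Mathlib
import Summits.MatrixMultiplication.MatrixMultiplication.Theorems.SnSubsetDichotomyPolynomialSlackHubFibring
import Summits.MatrixMultiplication.MatrixMultiplication.Theorems.SnSubsetDichotomyPolynomialSlackBlockCounts

/-!
# Heavy cells of a quotient set force a small volume (two dense quotients)

Crux `Summit.MatrixMultiplication.MatrixMultiplication.Theses.SnSubsetDichotomy.PolynomialSlack`
(item `stmt-MatrixMultiplication-8306`), helper file of lead c6 (line `transport-split-hull`, programme
BEYOND ONE HALF), induction on `n` for TPP volumes, case "two dense quotients". For `U, S ⊆ S_n` and
positions `k, i` the PAIR MARGINAL `m_{US}(k,i) = #{(u,s) ∈ U × S : s i = u k}` counts the pairs whose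
values at `k` and `i` agree. A cell `(k,i)` is HEAVY at level `θ` when `m_{US}(k,i) ≥ θ·|U||S|`.

* `pairMarginal_sq_le_max_mul` — fibring over the common value `v` (`a_v = #{u : u k = v}`,
  `b_v = #{s : s i = v}`, `m_{US}(k,i) = Σ_v a_v b_v`, `Σ_v a_v = |U|`, `Σ_v b_v = |S|`) and
  Cauchy–Schwarz give `m_{US}(k,i)² ≤ (max_v a_v b_v)·|U|·|S|` (in `ℕ`, for any dominating `M`);
* `volume_le_of_heavy_cell` — if `B` bounds the volumes of TPP triples of `S_{n-1}` and `(k,i)` is a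
  heavy cell at level `θ ≥ 0` of a TPP triple `(S, T, U)` of `S_n`, then `θ²·|S||T||U| ≤ n·B`:
  by the previous item `θ²·|U||S| ≤ a_{v*} b_{v*}` for a dominant common value `v*`, and the cell
  fibring `b_{v*}·|T|·a_{v*} ≤ n·B` (`cell_fibring`).
-/

namespace Summit.MatrixMultiplication.MatrixMultiplication.Theorems.PolynomialSlack

open scoped BigOperators
open Finset
open Literature.Combinatorics.Additive (TripleProductProperty)

set_option linter.dupNamespace false

/-- The fibre counts `#{x ∈ X : x k = v}` over the value `v` sum to `|X|`. [folklore] -/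
theorem sum_card_filter_apply_eq_val_eq_card {n : ℕ} (X : Finset (Equiv.Perm (Fin n))) (k : Fin n) :
    ∑ v : Fin n, (X.filter fun x => x k = v).card = X.card := by
  classical
  rw [Finset.card_eq_sum_card_fiberwise (f := fun x : Equiv.Perm (Fin n) => x k) (s := X)
    (t := Finset.univ) (fun _ _ => Finset.mem_univ _)]

/-- **Cauchy–Schwarz on a cell.** If `M` dominates every product `#{u ∈ U : u k = v}·#{s ∈ S : s i = v}`
of common-value fibre counts, then `m_{US}(k,i)² ≤ M·(|U|·|S|)`, where
`m_{US}(k,i) = #{(u,s) ∈ U × S : s i = u k} = Σ_v a_v b_v` (`a_v = #{u : u k = v}`, `b_v = #{s : s i = v}`):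
`(Σ_v a_v b_v)² ≤ (Σ_v M a_v)(Σ_v b_v)` since `(a_v b_v)² ≤ (M a_v) b_v`. [folklore] -/
theorem pairMarginal_sq_le_max_mul {n : ℕ} (U S : Finset (Equiv.Perm (Fin n))) (i k : Fin n) (M : ℕ)
    (hM : ∀ v : Fin n, (U.filter fun u => u k = v).card * (S.filter fun s => s i = v).card ≤ M) :
    ((U ×ˢ S).filter fun us => us.2 i = us.1 k).card ^ 2 ≤ M * (U.card * S.card) := by
  classical
  rw [pairMarginal_eq_sum_mul_nat U S k i]
  have hcs := Finset.sum_sq_le_sum_mul_sum_of_sq_le_mul (Finset.univ : Finset (Fin n))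
    (r := fun v => (U.filter fun u => u k = v).card * (S.filter fun s => s i = v).card)
    (f := fun v => M * (U.filter fun u => u k = v).card)
    (g := fun v => (S.filter fun s => s i = v).card)
    (fun _ _ => Nat.zero_le _) (fun _ _ => Nat.zero_le _) (fun v _ => by
      have hv := hM v
      calc ((U.filter fun u => u k = v).card * (S.filter fun s => s i = v).card) ^ 2
          = ((U.filter fun u => u k = v).card * (S.filter fun s => s i = v).card) *
              ((U.filter fun u => u k = v).card * (S.filter fun s => s i = v).card) := sq _
        _ ≤ M * ((U.filter fun u => u k = v).card * (S.filter fun s => s i = v).card) :=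
            Nat.mul_le_mul_right _ hv
        _ = M * (U.filter fun u => u k = v).card * (S.filter fun s => s i = v).card :=
            (mul_assoc _ _ _).symm)
  rw [← Finset.mul_sum, sum_card_filter_apply_eq_val_eq_card U k,
    sum_card_filter_apply_eq_val_eq_card S i] at hcs
  simpa only [mul_assoc] using hcs

/-- **Heavy cell ⇒ small volume.** If `B` bounds the volume `|S'||T'||U'|` of every TPP triple of
`S_{n-1}` (`n ≥ 1`), `(S, T, U)` is a TPP triple of `S_n`, and the cell `(k,i)` of the quotient `U⁻¹S`
is heavy at level `θ ≥ 0`, i.e. `θ·|U||S| ≤ m_{US}(k,i) = #{(u,s) ∈ U × S : s i = u k}`, then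
`θ²·|S||T||U| ≤ n·B`. Proof: with `a_v = #{u : u k = v}`, `b_v = #{s : s i = v}` and a dominant value
`v*` (maximising `a_v b_v`), Cauchy–Schwarz gives `m² ≤ a_{v*} b_{v*}·|U||S|`
(`pairMarginal_sq_le_max_mul`), so `θ²·|U||S| ≤ a_{v*} b_{v*}`; and the cell fibring over `Stab(v*)`
gives `b_{v*}·|T|·a_{v*} ≤ n·B` (`cell_fibring`). [folklore] -/
theorem volume_le_of_heavy_cell {n : ℕ} (hn : 1 ≤ n) (B : ℕ)
    (hB : ∀ S' T' U' : Finset (Equiv.Perm (Fin (n - 1))), TripleProductProperty S' T' U' →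
      S'.card * T'.card * U'.card ≤ B)
    {S T U : Finset (Equiv.Perm (Fin n))} (h : TripleProductProperty S T U) (i k : Fin n) (θ : ℝ)
    (hθ : 0 ≤ θ)
    (hcell : θ * (U.card * S.card : ℕ) ≤ ((U ×ˢ S).filter fun us => us.2 i = us.1 k).card) :
    θ ^ 2 * (S.card * T.card * U.card : ℕ) ≤ n * B := by
  classical
  -- a dominant common value `w`
  haveI : Nonempty (Fin n) := ⟨⟨0, hn⟩⟩
  obtain ⟨w, -, hw⟩ := Finset.exists_max_image (Finset.univ : Finset (Fin n))
    (fun v => (U.filter fun u => u k = v).card * (S.filter fun s => s i = v).card) Finset.univ_nonempty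
  set M : ℕ := (U.filter fun u => u k = w).card * (S.filter fun s => s i = w).card with hMdef
  -- Cauchy–Schwarz: `m² ≤ M·|U||S|` (in `ℕ`)
  have hkey : ((U ×ˢ S).filter fun us => us.2 i = us.1 k).card ^ 2 ≤ M * (U.card * S.card) :=
    pairMarginal_sq_le_max_mul U S i k M fun v => hw v (Finset.mem_univ v)
  -- cell fibring: `M·|T| ≤ n·B` (in `ℕ`)
  have hfib : M * T.card ≤ n * B := by
    have hc := cell_fibring B hB h i k w
    calc M * T.card = (S.filter fun s => s i = w).card * T.card * (U.filter fun u => u k = w).card := by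
          rw [hMdef]; ring
      _ ≤ n * B := hc
  -- real bookkeeping
  rcases Nat.eq_zero_or_pos (U.card * S.card) with hP | hP
  · have h0 : S.card * T.card * U.card = 0 := by
      rcases Nat.mul_eq_zero.1 hP with h0 | h0 <;> simp [h0]
    rw [h0]
    push_cast
    rw [mul_zero]
    positivity
  · have hPr : (0 : ℝ) < (U.card * S.card : ℕ) := by exact_mod_cast hP
    have hkeyr : (((U ×ˢ S).filter fun us => us.2 i = us.1 k).card : ℝ) ^ 2 ≤
        (M : ℝ) * (U.card * S.card : ℕ) := by exact_mod_cast hkey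
    have hfibr : (M : ℝ) * (T.card : ℝ) ≤ (n : ℝ) * (B : ℝ) := by exact_mod_cast hfib
    have h1 : (θ * (U.card * S.card : ℕ)) ^ 2 ≤
        (((U ×ˢ S).filter fun us => us.2 i = us.1 k).card : ℝ) ^ 2 :=
      pow_le_pow_left₀ (mul_nonneg hθ hPr.le) hcell 2
    have h2 : θ ^ 2 * (U.card * S.card : ℕ) * (U.card * S.card : ℕ) ≤
        (M : ℝ) * (U.card * S.card : ℕ) := by
      calc θ ^ 2 * (U.card * S.card : ℕ) * (U.card * S.card : ℕ)
          = (θ * (U.card * S.card : ℕ)) ^ 2 := by ring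
        _ ≤ _ := h1.trans hkeyr
    have h3 : θ ^ 2 * (U.card * S.card : ℕ) ≤ (M : ℝ) := le_of_mul_le_mul_right h2 hPr
    have h4 : θ ^ 2 * (U.card * S.card : ℕ) * (T.card : ℝ) ≤ (M : ℝ) * (T.card : ℝ) :=
      mul_le_mul_of_nonneg_right h3 (Nat.cast_nonneg _)
    calc θ ^ 2 * (S.card * T.card * U.card : ℕ)
        = θ ^ 2 * (U.card * S.card : ℕ) * (T.card : ℝ) := by push_cast; ring
      _ ≤ (M : ℝ) * (T.card : ℝ) := h4
      _ ≤ n * B := hfibr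

end Summit.MatrixMultiplication.MatrixMultiplication.Theorems.PolynomialSlack
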